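import Summits.CriticalPhenomena.PercolationContinuityZ3.Theorems.PercNearOneGluingNoHeavyPcintNawRandForcing
import HarnessLib

/-!
# PCINT lane, reduction B3r (kind `chordrand_cw`): forcing lemmas for BOND percolation

Cell `prim-pcint`, seat `prim-pcint-2`; memo `run/shared/lean/prim/pcint/REDUCTIONS.md` §B3+.1, §B3r, §B3r.6.
Does NOT build on p205010.

Bond analogue of `…PcintNawRandForcing`: for a bond configuration `ω ⊆ E(𝕃^d)` let `bgeoWords ω n` be
the words of length `n` whose `n` edges are open and whose endpoint is at open-graph distance `n` from
the origin.  For the code-least such word `γ` (w.r.t. a family `o` of sibling orders, as in B2r):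
* every chord of `γ` is closed (`chord_not_mem_of_mem_bgeoWords`);
* (gap pair) for any site `w` and incidences `i + 3 ≤ j`: the edges `{v_i, w}`, `{w, v_j}` are not both
  open (`not_pairOpen_of_gap`);
* (corner pair) for a bad corner `s`: the edges `{v_s, c}`, `{c, v_{s+2}}` through the corner site `c`
  are not both open (`not_cornerPairOpen_of_minimal`) — otherwise the flipped word is an open geodesic
  word with smaller code.
-/

noncomputable section

namespace Summit.CriticalPhenomena.PercolationContinuityZ3.Theorems.Pcint

open Finset Literature.Probability.Percolation Literature.Probability.LatticeModels

variable {d n : ℕ}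

/-! ### Open geodesic words of a bond configuration -/

open Classical in
/-- The OPEN GEODESIC words of length `n` of a bond configuration: all `n` edges open and the endpoint
at open-graph distance exactly `n` from the origin. [folklore] -/
def bgeoWords (ω : BondConfig (Site d)) (n : ℕ) : Finset (Fin n → Fin d × Bool) :=
  univ.filter fun γ => (↑(wordEdges γ) : Set (Sym2 (Site d))) ⊆ ω ∧ (openGraph ω).dist 0 (wordPos γ n) = n

/-- Membership in `bgeoWords`. [folklore] -/
theorem mem_bgeoWords {ω : BondConfig (Site d)} {γ : Fin n → Fin d × Bool} :
    γ ∈ bgeoWords ω n ↔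
      (↑(wordEdges γ) : Set (Sym2 (Site d))) ⊆ ω ∧ (openGraph ω).dist 0 (wordPos γ n) = n := by
  classical
  rw [bgeoWords, mem_filter, and_iff_right (mem_univ _)]

/-- The `k`-th edge of a word is one of its edges. [folklore] -/
theorem edge_mem_wordEdges (γ : Fin n → Fin d × Bool) {k : ℕ} (hk : k < n) :
    s(wordPos γ k, wordPos γ (k + 1)) ∈ wordEdges γ := by
  rw [wordEdges, mem_image]; exact ⟨k, mem_range.2 hk, rfl⟩

/-- An open word carries an open walk of length `j - i` from `v_i` to `v_j`. [folklore] -/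
theorem exists_openWalk_wordPos_bond {ω : BondConfig (Site d)} {γ : Fin n → Fin d × Bool}
    (hopen : (↑(wordEdges γ) : Set (Sym2 (Site d))) ⊆ ω) {i j : ℕ} (hij : i ≤ j) (hj : j ≤ n) :
    ∃ W : (openGraph ω).Walk (wordPos γ i) (wordPos γ j), W.length = j - i := by
  induction j, hij using Nat.le_induction with
  | base => exact ⟨SimpleGraph.Walk.nil, by simp⟩
  | succ j hij ih =>
    obtain ⟨W, hW⟩ := ih (by omega)
    have hadj : (openGraph ω).Adj (wordPos γ j) (wordPos γ (j + 1)) :=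
      (openGraph_adj ω _ _).2 ⟨hopen (mem_coe.2 (edge_mem_wordEdges γ (by omega))),
        (zdGraph_adj_wordPos_succ γ (by omega)).ne⟩
    exact ⟨W.concat hadj, by rw [SimpleGraph.Walk.length_concat, hW]; omega⟩

/-- **No shortcut** for open geodesic words (bond). [folklore] -/
theorem no_shortcut_of_mem_bgeoWords {ω : BondConfig (Site d)} {γ : Fin n → Fin d × Bool}
    (hγ : γ ∈ bgeoWords ω n) {i j : ℕ} (hi : i ≤ n) (hj : j ≤ n)
    (P : (openGraph ω).Walk (wordPos γ i) (wordPos γ j)) (hP : i + P.length < j) : False := by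
  obtain ⟨hopen, hdist⟩ := mem_bgeoWords.1 hγ
  obtain ⟨W₁, h₁⟩ := exists_openWalk_wordPos_bond hopen (Nat.zero_le i) hi
  obtain ⟨W₂, h₂⟩ := exists_openWalk_wordPos_bond hopen hj le_rfl
  have hle : (openGraph ω).dist (wordPos γ 0) (wordPos γ n) ≤ (i - 0) + P.length + (n - j) := by
    have := SimpleGraph.dist_le ((W₁.append P).append W₂)
    rwa [SimpleGraph.Walk.length_append, SimpleGraph.Walk.length_append, h₁, h₂] at this
  rw [wordPos_zero, hdist] at hle
  omega

/-- An open geodesic word (bond) is self-avoiding. [folklore] -/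
theorem isSAW_of_mem_bgeoWords {ω : BondConfig (Site d)} {γ : Fin n → Fin d × Bool}
    (hγ : γ ∈ bgeoWords ω n) : IsSAW γ := by
  intro i j hi hj hij
  by_contra hne
  rcases Nat.lt_or_gt_of_ne hne with h | h
  · exact no_shortcut_of_mem_bgeoWords hγ hi hj (SimpleGraph.Walk.nil.copy rfl hij) (by simp [h])
  · exact no_shortcut_of_mem_bgeoWords hγ hj hi (SimpleGraph.Walk.nil.copy rfl hij.symm) (by simp [h])

/-- **Chords of an open geodesic word are closed.** [folklore] -/
theorem chord_not_mem_of_mem_bgeoWords {ω : BondConfig (Site d)} {γ : Fin n → Fin d × Bool}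
    (hγ : γ ∈ bgeoWords ω n) {e : Sym2 (Site d)} (he : e ∈ chordEdges γ) : e ∉ ω := by
  intro heω
  obtain ⟨i, j, hij, hjn, hadj, rfl⟩ := mem_chordEdges.1 he
  have hop : (openGraph ω).Adj (wordPos γ i) (wordPos γ j) := (openGraph_adj ω _ _).2 ⟨heω, hadj.ne⟩
  exact no_shortcut_of_mem_bgeoWords hγ (by omega) hjn (SimpleGraph.Walk.cons hop SimpleGraph.Walk.nil)
    (by simp; omega)

/-- **(gap pair)** For an open geodesic word and any site `w`: the two edges `{v_i, w}`, `{w, v_j}` with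
`i + 3 ≤ j` are not both open (they would shortcut the geodesic). [folklore] -/
theorem not_pairOpen_of_gap {ω : BondConfig (Site d)} (hω : ω ⊆ (zdGraph d).edgeSet)
    {γ : Fin n → Fin d × Bool} (hγ : γ ∈ bgeoWords ω n) {w : Site d} {i j : ℕ} (hij : i + 3 ≤ j)
    (hj : j ≤ n) : ¬ (s(wordPos γ i, w) ∈ ω ∧ s(w, wordPos γ j) ∈ ω) := by
  rintro ⟨h1, h2⟩
  have a1 : (zdGraph d).Adj (wordPos γ i) w := by simpa using hω h1
  have a2 : (zdGraph d).Adj w (wordPos γ j) := by simpa using hω h2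
  have o1 : (openGraph ω).Adj (wordPos γ i) w := (openGraph_adj ω _ _).2 ⟨h1, a1.ne⟩
  have o2 : (openGraph ω).Adj w (wordPos γ j) := (openGraph_adj ω _ _).2 ⟨h2, a2.ne⟩
  exact no_shortcut_of_mem_bgeoWords hγ (by omega) hj
    (SimpleGraph.Walk.cons o1 (SimpleGraph.Walk.cons o2 SimpleGraph.Walk.nil)) (by simp; omega)

/-! ### Existence and the code-least open geodesic word -/

/-- **Long open geodesics exist** (bond): if `C(0)` is infinite and `ω ⊆ E(𝕃^d)`, `bgeoWords ω n ≠ ∅`.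
[folklore] -/
theorem bgeoWords_nonempty_of_percolatesAt {ω : BondConfig (Site d)} (hω : ω ⊆ (zdGraph d).edgeSet)
    (hC : ω ∈ percolatesAt (0 : Site d)) (n : ℕ) : (bgeoWords ω n).Nonempty := by
  classical
  have hG : openGraph ω ≤ zdGraph d := by
    intro a b hab
    rw [openGraph_adj] at hab
    exact hω hab.1
  have hC' : (openCluster ω 0).Infinite := hC
  set S : Set (Site d) := ⋃ k : Fin n, Set.range fun w : Fin k → Fin d × Bool => wordPos w k
  have hS : S.Finite := Set.finite_iUnion fun _ => Set.finite_range _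
  obtain ⟨y, hyC, hyS⟩ := (hC'.sdiff hS).nonempty
  obtain ⟨r, -, hrl⟩ := (hyC : (openGraph ω).Reachable 0 y).exists_path_of_dist
  have hn : n ≤ r.length := by
    by_contra hlt
    push Not at hlt
    obtain ⟨w, hw⟩ := exists_word_of_walk hG r r.length le_rfl
    exact hyS (Set.mem_iUnion.2 ⟨⟨r.length, hlt⟩, w, by simpa using hw r.length le_rfl⟩)
  obtain ⟨w, hw⟩ := exists_word_of_walk hG r n hn
  refine ⟨w, mem_bgeoWords.2 ⟨fun e he => ?_, ?_⟩⟩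
  · rw [Finset.mem_coe, wordEdges, Finset.mem_image] at he
    obtain ⟨k, hk, rfl⟩ := he
    rw [Finset.mem_range] at hk
    rw [hw k hk.le, hw (k + 1) hk]
    exact ((openGraph_adj ω _ _).1 (r.adj_getVert_succ (lt_of_lt_of_le hk hn))).1
  · rw [hw n le_rfl]
    apply le_antisymm
    · have := SimpleGraph.dist_le (r.take n)
      rw [SimpleGraph.Walk.take_length, Nat.min_eq_left hn] at this
      exact this
    · by_contra hlt
      push Not at hlt
      obtain ⟨Q, hQ⟩ := (r.take n).reachable.exists_walk_length_eq_dist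
      have hle := SimpleGraph.dist_le (Q.append (r.drop n))
      rw [SimpleGraph.Walk.length_append, hQ, SimpleGraph.Walk.drop_length, ← hrl] at hle
      omega

/-- For every family of sibling orders there is a code-least open geodesic word (bond). [folklore] -/
theorem exists_minimal_bgeoWord {ω : BondConfig (Site d)} (hω : ω ⊆ (zdGraph d).edgeSet)
    (hC : ω ∈ percolatesAt (0 : Site d)) (o : Orders d n) :
    ∃ γ ∈ bgeoWords ω n, ∀ γ' ∈ bgeoWords ω n, code o γ ≤ code o γ' :=
  exists_min_image _ (code o) (bgeoWords_nonempty_of_percolatesAt hω hC n)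

/-! ### The flipped word (bond) -/

/-- The edges of the flipped word: the old ones, or the two edges through the corner site. [folklore] -/
theorem mem_wordEdges_flipAt {γ : Fin n → Fin d × Bool} {s : ℕ} (h : s + 2 ≤ n) {e : Sym2 (Site d)}
    (he : e ∈ wordEdges (flipAt γ s h)) :
    e ∈ wordEdges γ ∨ e = s(wordPos γ s, cornerSite γ s) ∨ e = s(cornerSite γ s, wordPos γ (s + 2)) := by
  rw [wordEdges, mem_image] at he
  obtain ⟨k, hk, rfl⟩ := he
  rw [mem_range] at hk
  by_cases h1 : k = s
  · subst h1
    right; left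
    rw [wordPos_flipAt_of_ne γ h (by omega), wordPos_flipAt_succ]
  by_cases h2 : k = s + 1
  · subst h2
    right; right
    rw [wordPos_flipAt_succ, wordPos_flipAt_of_ne γ h (by omega)]
  left
  rw [wordPos_flipAt_of_ne γ h (by omega), wordPos_flipAt_of_ne γ h (by omega)]
  exact edge_mem_wordEdges γ hk

/-- **(corner pair, i)** If both edges through the corner site are open, the flipped word is again an
open geodesic word. [folklore] -/
theorem flipAt_mem_bgeoWords {ω : BondConfig (Site d)} {γ : Fin n → Fin d × Bool}
    (hγ : γ ∈ bgeoWords ω n) {s : ℕ} (h : s + 2 ≤ n)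
    (h1 : s(wordPos γ s, cornerSite γ s) ∈ ω) (h2 : s(cornerSite γ s, wordPos γ (s + 2)) ∈ ω) :
    flipAt γ s h ∈ bgeoWords ω n := by
  obtain ⟨hopen, hdist⟩ := mem_bgeoWords.1 hγ
  refine mem_bgeoWords.2 ⟨fun e he => ?_, ?_⟩
  · rcases mem_wordEdges_flipAt h (mem_coe.1 he) with he' | rfl | rfl
    · exact hopen (mem_coe.2 he')
    · exact h1
    · exact h2
  · rw [wordPos_flipAt_of_ne γ h (by omega)]; exact hdist

/-- **(corner pair, ii)** For the code-least open geodesic word and a bad corner `s`, the two edges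
through the corner site are not both open. [folklore] -/
theorem not_cornerPairOpen_of_minimal {ω : BondConfig (Site d)} {o : Orders d n}
    {γ : Fin n → Fin d × Bool} (hγ : γ ∈ bgeoWords ω n)
    (hmin : ∀ γ' ∈ bgeoWords ω n, code o γ ≤ code o γ') {s : ℕ} (hbad : IsBad o γ s) :
    ¬ (s(wordPos γ s, cornerSite γ s) ∈ ω ∧ s(cornerSite γ s, wordPos γ (s + 2)) ∈ ω) := by
  rintro ⟨h1, h2⟩
  obtain ⟨h, hlt⟩ := hbad
  exact (code_flipAt_lt h ⟨h, hlt⟩).not_ge (hmin _ (flipAt_mem_bgeoWords hγ h h1 h2))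

/-- Open geodesic words (bond) are self-avoiding words of the lattice. [folklore] -/
theorem mem_sawWords_of_mem_bgeoWords {ω : BondConfig (Site d)} {γ : Fin n → Fin d × Bool}
    (hγ : γ ∈ bgeoWords ω n) : γ ∈ sawWords d n :=
  mem_sawWords.2 (isSAW_of_mem_bgeoWords hγ)

end Summit.CriticalPhenomena.PercolationContinuityZ3.Theorems.Pcint
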